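import Summits.BirchSwinnertonDyer.Rank1Residual.X11b.BDPRouteOpenInputOdd
import Summits.BirchSwinnertonDyer.Rank1Residual.X11b.CastellaErratumTwistUnits
import Literature.NumberTheory.EllipticCurves.Rank1Residual.Typed.PAdicCertificateMultiplicativeThree
import Literature.NumberTheory.QuadraticFields.KroneckerSplitting
import Literature.NumberTheory.QuadraticFields.FormIdeals
import Mathlib.GroupTheory.Perm.Cycle.Type
import HarnessLib

/-!
# X11b at `p = 3` (team N8/O2, `cells/x11b3/`): STEP L at `3 ∥ N` as ONE typed conjecture on tree
# objects — the statement of record at `p = 3`, its two automatic side conditions PROVED, and why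
# the kernel cannot yet separate "IMC divisibility" from "BDP formula"

HONEST FRAMING (cell `b2b-bsdres`, run/shared/lean/b2b/bsd-rank1-residual/, verbatim in every
file): the goal of the cell is to DELETE the COMBINATION-SHAPED residual classes of the
Birch–Swinnerton-Dyer formula for ALL analytic-rank `≤ 1` elliptic curves over `ℚ` — "full BSD
formula for every rank `≤ 1` curve in class `C`" assembled STRICTLY from published theorems — so
that the rank-`≤ 1` remainder becomes exactly the CONSTRUCTION-SHAPED classes, which are TYPED
(missing-input `Prop`s), NOT attempted. This is not "finishing BSD". Team N8/O2 = `x11b3`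
(X11b at `p = 3`: `3 ∥ N`, `ord_{s=1} L(E,s) = 1`, `E[3]` irreducible), seat `b2b-bsdres-x11b3-p1`,
sub-target `L3-S1` of `cells/x11b3/OWNERS.md`; a RESEARCH ROUTE; no claim beyond the stated class;
RESIDUAL-MAP §I O2 (X11b at 3: OPEN) is NOT changed by anything here; the census relation X11b-1 is
EVIDENCE for the shape of the leading term and is not used. ONE `Prop`-valued PREDICATE on `W`
(shape only, nothing asserted, `[claim: …, status: open]`) and THEOREMS; no named fact; no `sorry`.

## What this file does

1. **The typed STEP-L-at-3 conjecture with its exact normalisation** (`X11b.Three.StepLAt W`). It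
   is multr1-p2's odd-prime open input `P2OpenInputOnTreeOddAt W 3` (`BDPRouteOpenInputOdd.lean`)
   — "(IMC≥)∘(BDP) at the trivial character on tree objects": for every generator `f` (with
   `f(0) ≠ 0`) of the characteristic ideal of the constructed `Λ`-torsion anticyclotomic Selmer
   dual `X_ac(E[3^∞]/K_∞) = AcSelmer.XAc (E_K) 3 κ 𝔭 ∅ γ`, `2·(ord₃ log_{ω_E} P − 1) ≤ ord₃ f(0)`,
   `P ∈ E(K)` the Heegner point of a parametrisation datum with `3 ∤ c`, `log` read in
   `E(K_𝔭) = E(ℚ₃)` through THE embedding `embAt K 3 𝔭` (`IMCLowerWaldspurgerOnTreeAt`) — with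
   the two binders of that predicate that are THEOREMS at a multiplicative `3` REMOVED:
   `¬ (3 : ℤ) ∣ d_K` and `¬ 3 ∣ #𝓞_K^×`. Both follow from the Heegner hypothesis for `N_E` and
   `3 ∣ N_E` (`3` splits in `K`): §1 proves, for any quadratic `K`, (i) a prime `p ≠ 2` with two
   primes of `𝓞 K` above it does not divide `d_K` (decomposition law, tree
   `ncard_primesOver_eq_two_iff_legendreSym`), (ii) `3 ∣ #𝓞_K^× ⟹ d_K = −3` (a cube root of unity
   `ζ = a + cω` in an integral basis `(1, ω)`, `ω² = m + tω`, forces `c²·(t² + 4m) = −3`), hence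
   (iii) an ODD prime that splits in `K` does not divide `#𝓞_K^×` (for `p ≥ 5` this is the tree's
   `not_dvd_torsionOrder_of_finrank_le_two`). `stepLAt_iff_p2OpenInputOnTreeOddAt` records that the
   trimmed predicate is EQUIVALENT to multr1-p2's. NO source, printed or announced, asserts
   `StepLAt` at `3 ∥ N`: Howard 2007 Hyp. 1.0.1 "`p ∤ 6N`", Castella 2020 §1 / Castella 2018 "`p ≥ 5`",
   Skinner–Zhang 2014 "`p ≥ 5` throughout", the erratum's Thm. A′ "`p > 3`" (team REFEREE.md §2,
   rows H1–H6). It is a predicate; NEVER a theorem in this cell.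
2. **The statement of record at `p = 3` with the trimmed input** (`X11b.Three.bsdp_of_stepLAt`):
   `∀ E, (E,3) ∈ X11b → BSD(E,3)` ⇐ the TWELVE published named facts of
   `P2.bsdp_three_of_onTree` + `∀ W, StepLAt W` [OPEN, no source] + (T2′)@3 [the Euler-system half
   off the atom `(ram) ∧ 3 ∤ ∏ c_ℓ`] + (T4″)@3 [the `3Ns/3Nn` corner]; and the class's typed input
   `X11Three.MissingInputAt` at every such pair (`missingInputAt_of_stepLAt`). CONDITIONAL; nothing
   booked; O2 unchanged.
3. **Why the kernel cannot (yet) split STEP L at 3 into "anticyclotomic IMC divisibility" +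
   "BDP formula"** (`imcLowerWaldspurgerOnTreeAt_iff_exists_value`): in print the two halves share
   the OBJECT `L₃^{BDP}(f/K) ∈ Λ^{ur}` (its value at `𝟙`); the tree has no such object (CGLS 2022
   Thm. 2.1.1 "characterized by interpolation" is untyped — `BDPValueAtTrivialCharacter.lean`,
   module docstring), so a split through a free `ℤ`-valued "valuation of the `L`-value" binder `v`
   — (IMC≥)₃ `v ≤ ord₃ f(0)` and (BDP)₃ `v = 2(ord₃ log_ω P − 1)` — is LOGICALLY IDLE: `∃ v` of the
   conjunction is equivalent to `StepLAt`'s body. Consequence for the team plan: the sub-targets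
   "IMC divisibility at 3" and "BDP formula at 3" become separately typable only AFTER an object for
   the `3`-adic anticyclotomic `L`-function of the `3`-new form (with its characterising
   interpolation property) is typed — a definition item for the planners, not taken here.

References: [Castella2018] Thm. 2.3, Thm. 3.2, §5 (arXiv:1704.06608 pp. 5, 9, 12);
[Castella2018Erratum] (2.4), Thm. A′; [JetchevSkinnerWan2017] §7.4.1; [Howard2007] Hyp. 1.0.1;
[CastellaGrossiLeeSkinner2022] Thm. 2.1.1; team file `cells/x11b3/REFEREE.md` §2 (H1–H14).
-/

noncomputable section

open scoped Classical

open WeierstrassCurve NumberField IsDedekindDomain Field Module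
  Literature.NumberTheory.EllipticCurves Literature.NumberTheory.EllipticCurves.GreenbergSelmer
  Literature.NumberTheory.EllipticCurves.ModularForms
  Literature.NumberTheory.EllipticCurves.Rank1Residual
  Literature.NumberTheory.EllipticCurves.Rank1Residual.Typed
  Literature.NumberTheory.EllipticCurves.Wuthrich2014
  Literature.NumberTheory.EllipticCurves.BalakrishnanEtAl2019
  Literature.NumberTheory.QuadraticFields.Quadratic
  Literature.NumberTheory.Automorphic
  Literature.NumberTheory.GaloisRepresentations Literature.NumberTheory.GaloisCohomology
  Summit.BirchSwinnertonDyer.Rank1Residual.X11b.AcSelmer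
  Summit.BirchSwinnertonDyer.Rank1Residual.X11b.LocBridge

namespace Summit.BirchSwinnertonDyer.Rank1Residual.X11b.Three

/-! ### §1 Two side conditions of the open input are theorems at a split prime -/

section Quadratic

variable {K : Type} [Field K] [NumberField K]

/-- **A cube root of unity in a quadratic field forces `d_K = −3`.** If `[K:ℚ] = 2` and
`ζ ∈ 𝓞 K` satisfies `ζ² + ζ + 1 = 0`, then `d_K = −3`: writing `ζ = a + cω` in an integral basis
`(1, ω)` with `ω² = m + tω` gives `a² + a + 1 + c²m = 0` and `c(2a + 1 + ct) = 0` with `c ≠ 0`,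
whence `c²(t² + 4m) = −3`, `c = ±1`, `d_K = t² + 4m = −3`. [folklore] -/
theorem discr_eq_neg_three_of_sq_add_self_add_one (h2 : finrank ℚ K = 2) {ζ : 𝓞 K}
    (hζ : ζ ^ 2 + ζ + 1 = 0) : NumberField.discr K = -3 := by
  obtain ⟨b, hb⟩ := exists_basis_zero_eq_one h2
  set m : ℤ := b.repr (b 1 * b 1) 0 with hm
  set t : ℤ := b.repr (b 1 * b 1) 1 with ht
  have hω : b 1 * b 1 = (m : 𝓞 K) + (t : 𝓞 K) * b 1 := basis_one_mul_self_eq b hb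
  have hd : NumberField.discr K = t ^ 2 + 4 * m := discr_eq_sq_add_four_mul b hb
  set a : ℤ := b.repr ζ 0 with ha
  set c : ℤ := b.repr ζ 1 with hc
  have hζac : ζ = (a : 𝓞 K) + (c : 𝓞 K) * b 1 := eq_repr_add_repr_mul_of_basis b hb ζ
  -- expand `ζ² + ζ + 1` in the basis
  have hexp : ζ ^ 2 + ζ + 1 =
      ((a ^ 2 + a + 1 + c ^ 2 * m : ℤ) : 𝓞 K) + ((2 * a * c + c + c ^ 2 * t : ℤ) : 𝓞 K) * b 1 := by
    rw [hζac]
    push_cast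
    linear_combination ((c : 𝓞 K)) ^ 2 * hω
  have hzero : ((a ^ 2 + a + 1 + c ^ 2 * m : ℤ) : 𝓞 K) + ((2 * a * c + c + c ^ 2 * t : ℤ) : 𝓞 K) * b 1
      = ((0 : ℤ) : 𝓞 K) + ((0 : ℤ) : 𝓞 K) * b 1 := by
    rw [← hexp, hζ]
    push_cast
    ring
  obtain ⟨hA, hB⟩ := intCast_add_intCast_mul_inj b hb hzero
  -- integer arithmetic
  have hc0 : c ≠ 0 := by
    rintro h0
    rw [h0] at hA
    nlinarith [sq_nonneg (2 * a + 1)]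
  have hB' : 2 * a + 1 + c * t = 0 := by
    have : c * (2 * a + 1 + c * t) = 0 := by linear_combination hB
    rcases mul_eq_zero.mp this with h | h
    · exact absurd h hc0
    · exact h
  have hkey : c ^ 2 * (t ^ 2 + 4 * m) = -3 := by
    have h1 : (2 * a + 1) ^ 2 = c ^ 2 * t ^ 2 := by
      have : 2 * a + 1 = -(c * t) := by linear_combination hB'
      rw [this]; ring
    linear_combination 4 * hA - h1
  have hc1 : 1 ≤ c ^ 2 := by
    have := Int.one_le_abs hc0
    nlinarith [sq_abs c]
  have hdneg : t ^ 2 + 4 * m < 0 := by nlinarith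
  have hcle : c ^ 2 ≤ 3 := by nlinarith
  have hcb : -1 ≤ c ∧ c ≤ 1 := by constructor <;> nlinarith
  obtain ⟨hcl, hcu⟩ := hcb
  rw [hd]
  interval_cases c
  · linarith
  · exact absurd rfl hc0
  · linarith

/-- **`3 ∣ #𝓞_K^× ⟹ d_K = −3`** for a quadratic field `K`: an element of order `3` of the (cyclic)
torsion of `𝓞_K^×` is a primitive cube root of unity `ζ ∈ 𝓞 K`, so `ζ² + ζ + 1 = 0` and the
previous lemma applies (`K = ℚ(√−3)` is the only quadratic field with `6` units). [folklore] -/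
theorem discr_eq_neg_three_of_three_dvd_torsionOrder (h2 : finrank ℚ K = 2)
    (h3 : 3 ∣ Units.torsionOrder K) : NumberField.discr K = -3 := by
  haveI : Fact (Nat.Prime 3) := ⟨Nat.prime_three⟩
  have h3' : 3 ∣ Nat.card (Units.torsion K) := by rwa [Units.torsionOrder] at h3
  obtain ⟨g, hg⟩ := exists_prime_orderOf_dvd_card' 3 h3'
  set ζ : 𝓞 K := (((g : (𝓞 K)ˣ)) : 𝓞 K) with hζdef
  have horder : orderOf ζ = 3 := by
    rw [hζdef, orderOf_units, Subgroup.orderOf_coe, hg]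
  have hζ3 : ζ ^ 3 = 1 := by rw [← horder]; exact pow_orderOf_eq_one ζ
  have hζ1 : ζ ≠ 1 := by
    intro h1
    rw [h1, orderOf_one] at horder
    exact absurd horder (by norm_num)
  have hfac : (ζ - 1) * (ζ ^ 2 + ζ + 1) = 0 := by
    have : (ζ - 1) * (ζ ^ 2 + ζ + 1) = ζ ^ 3 - 1 := by ring
    rw [this, hζ3, sub_self]
  rcases mul_eq_zero.mp hfac with h | h
  · exact absurd (sub_eq_zero.mp h) hζ1
  · exact discr_eq_neg_three_of_sq_add_self_add_one h2 h

/-- **A prime `p ≠ 2` that splits in a quadratic field does not divide its discriminant**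
(decomposition law: two primes above `p` iff `(d_K/p) = 1`, and `(d_K/p) = 0` when `p ∣ d_K`).
[folklore] -/
theorem not_dvd_discr_of_ncard_primesOver_eq_two (h2 : finrank ℚ K = 2) {p : ℕ} [Fact p.Prime]
    (hp2 : p ≠ 2) (hsplit : ((Ideal.span {(p : ℤ)}).primesOver (𝓞 K)).ncard = 2) :
    ¬ (p : ℤ) ∣ NumberField.discr K := by
  intro hdvd
  have h1 := (ncard_primesOver_eq_two_iff_legendreSym h2 hp2).mp hsplit
  have h0 : legendreSym p (NumberField.discr K) = 0 :=
    (legendreSym.eq_zero_iff p _).mpr ((ZMod.intCast_zmod_eq_zero_iff_dvd _ p).mpr hdvd)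
  rw [h0] at h1
  exact zero_ne_one h1

/-- **An odd prime that splits in a quadratic field does not divide `#𝓞_K^×`**: for `p ≥ 5` no
prime `≥ 5` divides `#𝓞_K^× ∈ {2, 4, 6}` (`not_dvd_torsionOrder_of_finrank_le_two`); for `p = 3`,
`3 ∣ #𝓞_K^×` forces `d_K = −3`, but then `3 ∣ d_K` ramifies, contradicting the splitting.
[folklore] -/
theorem not_dvd_torsionOrder_of_ncard_primesOver_eq_two (h2 : finrank ℚ K = 2) {p : ℕ}
    [Fact p.Prime] (hp2 : p ≠ 2) (hsplit : ((Ideal.span {(p : ℤ)}).primesOver (𝓞 K)).ncard = 2) :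
    ¬ p ∣ Units.torsionOrder K := by
  have hp : p.Prime := Fact.out
  by_cases hp5 : 5 ≤ p
  · exact not_dvd_torsionOrder_of_finrank_le_two K h2.le hp hp5
  · -- `p` is a prime `< 5`, `≠ 2`, so `p = 3`
    have hp3 : p = 3 := by
      have h2le := hp.two_le
      interval_cases p
      · exact absurd rfl hp2
      · rfl
      · exact absurd hp (by decide)
    subst hp3
    intro h3
    have hd := discr_eq_neg_three_of_three_dvd_torsionOrder h2 h3
    exact not_dvd_discr_of_ncard_primesOver_eq_two h2 hp2 hsplit ⟨-1, by rw [hd]; norm_num⟩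

/-- **At a prime `p ≠ 2` dividing the Heegner level the two side conditions hold**: if `K` is
imaginary quadratic and satisfies the Heegner hypothesis for `N` (every prime factor of `N`
splits), then for every prime `p ≠ 2` with `p ∣ N`: `p ∤ d_K` and `p ∤ #𝓞_K^×`. In the cell's use
`N = N_E` and `p ∥ N_E` is the multiplicative prime of an X11b pair. [folklore] -/
theorem not_dvd_discr_and_not_dvd_torsionOrder_of_heegner (hK : IsImaginaryQuadratic K) {N : ℕ}
    (hH : SatisfiesHeegnerHypothesis N K) {p : ℕ} [Fact p.Prime] (hp2 : p ≠ 2) (hpN : p ∣ N) :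
    ¬ (p : ℤ) ∣ NumberField.discr K ∧ ¬ p ∣ Units.torsionOrder K :=
  ⟨not_dvd_discr_of_ncard_primesOver_eq_two hK.1 hp2 (hH p Fact.out hpN),
    not_dvd_torsionOrder_of_ncard_primesOver_eq_two hK.1 hp2 (hH p Fact.out hpN)⟩

end Quadratic

/-! ### §2 The typed STEP-L-at-3 conjecture and the statement of record at `p = 3` -/

section Three

/-- OPEN CONJECTURE — **STEP L at `3 ∥ N`, the typed conjecture of team N8/O2, exact
normalisation (no source, not even announced)** [status: open]. For `W/ℚ` globally minimal with `(E, 3) ∈` X11b (`ord_{s=1} L(E,s)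
= 1`, `3 ∥ N_E`, `E[3]` irreducible) and `ρ̄_{E,3}` onto; for every imaginary quadratic `K` with
`d_K` odd satisfying the Heegner hypothesis for `N_E` and `L(E^{d_K}, 1) ≠ 0`; for every modular
parametrisation datum `Dt` of level `N_E` with `3 ∤ c` (its Manin constant) and every Heegner
datum `H`, with `P ∈ E(K)` THE Heegner point (`ι(P) = heegnerPointComplex Dt H`) of infinite order;
for every anticyclotomic `ℤ₃`-extension `κ` of `K` with topological generator `γ` and every
degree-one prime `𝔭 ∣ 3` of `K`: `IMCLowerWaldspurgerOnTreeAt 3 κ 𝔭 γ (embAt K 3 𝔭) P`, i.e.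
there is `n = ord₃ f(0)` for a generator `f` (with `f(0) ≠ 0`) of the characteristic ideal of the
`Λ = ℤ₃⟦T⟧`-torsion module `X_ac(E[3^∞]) = AcSelmer.XAc (E_K) 3 κ 𝔭 ∅ γ` with
`2 · (ord₃ log_{ω_E} P − 1) ≤ n` (`ord₃ log_{ω_E} P = padicLogOrd W 3 (embAt K 3 𝔭) P`). This is
the `p = 3` instance of multr1-p2's `P2OpenInputOnTreeOddAt` with the binders `¬ 3 ∣ d_K`,
`¬ 3 ∣ #𝓞_K^×` dropped (theorems at `3 ∥ N_E`, §1; `stepLAt_iff_p2OpenInputOnTreeOddAt`). In print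
its only derivation is (IMC≥) "`Ch_Λ(X_ac) Λ^{ur} ⊆ (L_p(f))`" [at `p ∥ N`: erratum (2.4) ⇐
Fouquet–Wan Thm. 4.41, `p ≥ 5`, UNREFEREED] ∘ (BDP at `p ∣ N`) [Castella 2018 Thm. 3.2, printed
for `p ≥ 5`]; at `p = 3` every load-bearing construction carries `p ∤ 6N` (Howard 2007) or `p ≥ 5`
(Castella 2018/2020, Skinner–Zhang 2014, erratum A′). A predicate on `W`; NEVER a theorem in this
cell; every result using it is CONDITIONAL; the architecture whose `p ≥ 5` version is claimed in
the erratum is the only one in print reaching `p ∥ N` [claim: Castella2018Erratum, status: under-review]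
(that claim is for `p > 3` ONLY — at `p = 3` nothing is claimed by anyone).
[cite: Castella2018, Thm. 3.2 (arXiv:1704.06608 p. 9) and §5 (p. 12) (shape only, read at p = 3; nothing asserted)] -/
def StepLAt (W : WeierstrassCurve ℚ) [W.IsElliptic] [W.IsGloballyMinimal] : Prop :=
  ∀ (N : ℕ) [NeZero N] (K : Type) [Field K] [NumberField K]
    (Dt : ModularParametrizationData W N) (H : HeegnerDatum N (NumberField.discr K)) (ι : K →+* ℂ)
    (P : (W.baseChange K).toAffine.Point),
    ClassX11b W 3 → Surj W 3 → W.conductorNorm ℤ = N → IsImaginaryQuadratic K →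
    Odd (NumberField.discr K) → SatisfiesHeegnerHypothesis N K →
    (W.quadraticTwist (NumberField.discr K : ℚ)).entireLFunction 1 ≠ 0 →
    WeierstrassCurve.Affine.Point.map ι.toRatAlgHom P = heegnerPointComplex Dt H →
    ¬ (3 : ℤ) ∣ Dt.c → ¬ IsOfFinAddOrder P →
    ∀ (κ : ZpExtension K 3), κ.IsAnticyclotomic →
      ∀ (γ : Field.absoluteGaloisGroup K) [Fact (κ.IsTopGenerator γ)]
        (𝔭 : HeightOneSpectrum (𝓞 K)) (h𝔭 : ((3 : ℕ) : 𝓞 K) ∈ 𝔭.asIdeal)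
        (he : 𝔭.asIdeal.ramificationIdx (𝓞 ℚ) = 1) (hf : 𝔭.asIdeal.inertiaDeg (𝓞 ℚ) = 1),
        IMCLowerWaldspurgerOnTreeAt 3 κ 𝔭 γ (embAt K 3 𝔭 h𝔭 he hf) P

variable {W : WeierstrassCurve ℚ} [W.IsElliptic] [W.IsGloballyMinimal]

omit [W.IsGloballyMinimal] in
/-- A multiplicative prime divides the conductor. [folklore] -/
theorem dvd_conductorNorm_of_classX11b {p : ℕ} [Fact p.Prime] (hX : ClassX11b W p) :
    p ∣ W.conductorNorm ℤ :=
  (W.dvd_conductorNorm_iff_not_hasGoodReductionAtPrime p).mpr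
    (WeierstrassCurve.HasMultiplicativeReduction.not_hasGoodReduction (R := ℤ_[p]) hX.2.2.1)

/-- The trimmed `p = 3` conjecture implies multr1-p2's odd-prime open input at `p = 3` (the two
extra binders are simply not used). [folklore] -/
theorem p2OpenInputOnTreeOddAt_of_stepLAt (h : StepLAt W) : P2OpenInputOnTreeOddAt W 3 :=
  fun N _ K _ _ Dt H ι P hX hs hN hK hodd _hpd _hμ hHN hLt hP hc hPinf κ hκ γ _ 𝔭 h𝔭 he hf ↦
    h N K Dt H ι P hX hs hN hK hodd hHN hLt hP hc hPinf κ hκ γ 𝔭 h𝔭 he hf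

/-- Conversely multr1-p2's odd-prime open input at `p = 3` implies the trimmed conjecture: the
binders `¬ 3 ∣ d_K`, `¬ 3 ∣ #𝓞_K^×` are supplied by
`not_dvd_discr_and_not_dvd_torsionOrder_of_heegner` (`3 ∣ N_E` by `ClassX11b W 3`). [folklore] -/
theorem stepLAt_of_p2OpenInputOnTreeOddAt (h : P2OpenInputOnTreeOddAt W 3) : StepLAt W := by
  intro N _ K _ _ Dt H ι P hX hs hN hK hodd hHN hLt hP hc hPinf κ hκ γ _ 𝔭 h𝔭 he hf
  have h3N : 3 ∣ N := hN ▸ dvd_conductorNorm_of_classX11b hX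
  obtain ⟨hpd, hμ⟩ :=
    not_dvd_discr_and_not_dvd_torsionOrder_of_heegner hK hHN (p := 3) (by decide) h3N
  exact h N K Dt H ι P hX hs hN hK hodd (by exact_mod_cast hpd) hμ hHN hLt hP hc hPinf κ hκ γ 𝔭
    h𝔭 he hf

/-- **The trimmed conjecture is EQUIVALENT to multr1-p2's open input at `p = 3`.** [folklore] -/
theorem stepLAt_iff_p2OpenInputOnTreeOddAt : StepLAt W ↔ P2OpenInputOnTreeOddAt W 3 :=
  ⟨p2OpenInputOnTreeOddAt_of_stepLAt, stepLAt_of_p2OpenInputOnTreeOddAt⟩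

/-- **Statement of record at `p = 3` with the trimmed input (team N8/O2).** `∀ E` with
`(E,3) ∈` X11b `→ BSD(E,3)` ⇐ the TWELVE published named facts of `P2.bsdp_three_of_onTree`
(Gross–Zagier, Kolyvagin ×2, Skinner 2016 Thm. C [`p ≥ 3`], Wuthrich 2014 Prop. 21, GZK,
modularity ×2, Hoffstein–Luo, Mazur 1978 Cor. 4.1, Poitou–Tate, local Euler characteristic) + the
typed inputs: (T1)₃ `∀ W, StepLAt W` [OPEN — no source, not announced]; (T2′)₃ the Euler-system
half off the atom `(ram) ∧ 3 ∤ ∏ c_ℓ` [OPEN]; (T4″)₃ the non-surjective corner `3 ∣ ord₃ Δ_min ∧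
¬(ram)` [OPEN]. CONDITIONAL; nothing booked; RESIDUAL-MAP §I O2 unchanged.
[cite: Castella2018, Thm. 2.3 (p. 5), Thm. 3.2 (p. 9)] [cite: Skinner2016PacificMC, Thm. C (§1) and footnote 1]
[cite: Wuthrich2014, Prop. 21 (p. 400)] [cite: Miller2011LMS, Def. 1.1] -/
theorem bsdp_of_stepLAt
    (hGZ : ∀ (N : ℕ) [NeZero N] (W : WeierstrassCurve ℚ) (K : Type) [Field K] [NumberField K],
      gross_zagier N W K)
    (hKo : ∀ (N : ℕ) [NeZero N] (W : WeierstrassCurve ℚ) (K : Type) [Field K] [NumberField K],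
      kolyvagin N W K)
    (hB : ∀ (N : ℕ) [NeZero N] (W : WeierstrassCurve ℚ) (K : Type) [Field K] [NumberField K],
      Kolyvagin1990_padicValNat_card_sha_le N W K)
    (hSk : Skinner2016.thmC_padicValRat_bsd_rank_zero) (hWu : sha_dvd_analyticSha)
    (hGZK : rank_eq_analyticRank_of_analyticRank_le_one) (hmod : hasEntireLFunction_rat)
    (hnf : exists_isNewformOf) (hHL : HoffsteinLuo1997_exists_twist_L_one_ne_zero)
    (hMaz : mazur_not_dvd_maninConstant_of_odd)
    (hPT : ∀ (K : Type) [Field K] [NumberField K], poitouTate_sum_localTatePairing_eq_zero K)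
    (hEP : ∀ (K : Type) [Field K] [NumberField K] (v : HeightOneSpectrum (𝓞 K)),
      localEulerPoincareCharacteristic (v.adicCompletion K))
    -- (T1)₃ STEP L at 3 ∥ N — OPEN, no source
    (hA : ∀ (W : WeierstrassCurve ℚ) [W.IsElliptic] [W.IsGloballyMinimal], StepLAt W)
    -- (T2′)₃ the Euler-system half off the unconditional atom (ram) ∧ `3 ∤ ∏ c_ℓ`
    (hU : ∀ (W : WeierstrassCurve ℚ) [W.IsElliptic] [W.IsGloballyMinimal],
      ClassX11b W 3 → Surj W 3 → ¬ (Ram W 3 ∧ ¬ 3 ∣ W.tamagawaProduct) →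
        Typed.MissingUpperBoundAt W 3)
    -- (T4″)₃ the non-surjective corner `3 ∣ ord₃ Δ_min`, no (ram) prime
    (hC : ∀ (W : WeierstrassCurve ℚ) [W.IsElliptic] [W.IsGloballyMinimal],
      ClassX11b W 3 → ¬ Surj W 3 → 3 ∣ padicValInt 3 W.minimalDiscriminantInt → ¬ Ram W 3 →
        Typed.MissingPPartAt W 3)
    (W : WeierstrassCurve ℚ) [W.IsElliptic] [W.IsGloballyMinimal] (hX : ClassX11b W 3) :
    BSDp W 3 :=
  P2.bsdp_three_of_onTree hGZ hKo hB hSk hWu hGZK hmod hnf hHL hMaz hPT hEP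
    (fun W _ _ ↦ p2OpenInputOnTreeOddAt_of_stepLAt (hA W)) hU hC W hX

/-- **Per-pair bookkeeping**: under the same inputs, the CLASS's typed missing input
`X11Three.MissingInputAt W` (REFEREE R6.2) holds at every X11b pair at `3`
(`X11Three.missingInputAt_of_bsdp`). CONDITIONAL; nothing booked. [cite: Miller2011LMS, Def. 1.1] -/
theorem missingInputAt_of_stepLAt
    (hGZ : ∀ (N : ℕ) [NeZero N] (W : WeierstrassCurve ℚ) (K : Type) [Field K] [NumberField K],
      gross_zagier N W K)
    (hKo : ∀ (N : ℕ) [NeZero N] (W : WeierstrassCurve ℚ) (K : Type) [Field K] [NumberField K],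
      kolyvagin N W K)
    (hB : ∀ (N : ℕ) [NeZero N] (W : WeierstrassCurve ℚ) (K : Type) [Field K] [NumberField K],
      Kolyvagin1990_padicValNat_card_sha_le N W K)
    (hSk : Skinner2016.thmC_padicValRat_bsd_rank_zero) (hWu : sha_dvd_analyticSha)
    (hGZK : rank_eq_analyticRank_of_analyticRank_le_one) (hmod : hasEntireLFunction_rat)
    (hnf : exists_isNewformOf) (hHL : HoffsteinLuo1997_exists_twist_L_one_ne_zero)
    (hMaz : mazur_not_dvd_maninConstant_of_odd)
    (hPT : ∀ (K : Type) [Field K] [NumberField K], poitouTate_sum_localTatePairing_eq_zero K)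
    (hEP : ∀ (K : Type) [Field K] [NumberField K] (v : HeightOneSpectrum (𝓞 K)),
      localEulerPoincareCharacteristic (v.adicCompletion K))
    (hA : ∀ (W : WeierstrassCurve ℚ) [W.IsElliptic] [W.IsGloballyMinimal], StepLAt W)
    (hU : ∀ (W : WeierstrassCurve ℚ) [W.IsElliptic] [W.IsGloballyMinimal],
      ClassX11b W 3 → Surj W 3 → ¬ (Ram W 3 ∧ ¬ 3 ∣ W.tamagawaProduct) →
        Typed.MissingUpperBoundAt W 3)
    (hC : ∀ (W : WeierstrassCurve ℚ) [W.IsElliptic] [W.IsGloballyMinimal],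
      ClassX11b W 3 → ¬ Surj W 3 → 3 ∣ padicValInt 3 W.minimalDiscriminantInt → ¬ Ram W 3 →
        Typed.MissingPPartAt W 3)
    (W : WeierstrassCurve ℚ) [W.IsElliptic] [W.IsGloballyMinimal] (hX : ClassX11b W 3) :
    X11Three.MissingInputAt W :=
  X11Three.missingInputAt_of_bsdp hmod hGZK W (le_of_eq hX.1)
    (bsdp_of_stepLAt hGZ hKo hB hSk hWu hGZK hmod hnf hHL hMaz hPT hEP hA hU hC W hX)

end Three

/-! ### §3 Why "IMC divisibility at 3" and "BDP formula at 3" are not yet separately typable -/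

section Split

variable {W : WeierstrassCurve ℚ} [W.IsElliptic] [W.IsGloballyMinimal] {K : Type} [Field K]
  [NumberField K] (p : ℕ) [Fact p.Prime] (κ : ZpExtension K p) (𝔭 : HeightOneSpectrum (𝓞 K))
  (γ : Field.absoluteGaloisGroup K) [Fact (κ.IsTopGenerator γ)] (ι : K →+* ℚ_[p])
  (P : (W.baseChange K).toAffine.Point)

/-- **A split of (IMC≥∘BDP) through a free "valuation of the `L`-value" is idle.** The printed
halves of STEP L are (IMC≥) "`Ch_Λ(X_ac) Λ^{ur} ⊆ (L_p(f))`", which at `𝟙` reads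
`ord_p L_p(f)(𝟙) ≤ ord_p f(0)`, and (BDP) "`L_p(f)(𝟙) = u · ((1 − a_p p⁻¹) log_{ω_E} P)²`", which
reads `ord_p L_p(f)(𝟙) = 2·(ord_p log_ω P − 1)`; they share the OBJECT `L_p(f)`, for which the
tree has no home. Replacing `ord_p L_p(f)(𝟙)` by a free integer `v`, the conjunction
`∃ v, (∃ n, HasCharValuationAt n ∧ v ≤ n) ∧ v = 2(ord_p log_ω P − 1)` is EQUIVALENT to
`IMCLowerWaldspurgerOnTreeAt` — the split carries no content until `v` is pinned by a typed
`L`-function object with an independent characterisation (interpolation property). Bookkeeping for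
the team plan; nothing arithmetic is proved. [folklore] -/
theorem imcLowerWaldspurgerOnTreeAt_iff_exists_value :
    IMCLowerWaldspurgerOnTreeAt p κ 𝔭 γ ι P ↔
      ∃ v : ℤ, (∃ n : ℕ, XAc.HasCharValuationAt (W.baseChange K) p κ 𝔭 ∅ γ n ∧ v ≤ (n : ℤ)) ∧
        v = 2 * (padicLogOrd W p ι P - 1) := by
  constructor
  · rintro ⟨n, hn, hle⟩
    exact ⟨2 * (padicLogOrd W p ι P - 1), ⟨n, hn, hle⟩, rfl⟩
  · rintro ⟨v, ⟨n, hn, hle⟩, rfl⟩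
    exact ⟨n, hn, hle⟩

end Split

end Summit.BirchSwinnertonDyer.Rank1Residual.X11b.Three

end
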